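import Literature.Probability.LatticeModels.CollarLegModelStrandsConsistency

/-!
# Stub `stub_realisability` of line `rainbow-monomials-in-excursion-kernels` — Part 17:
# the level pair of a strand is constant along consistent turns, for a general collar leg model
# (crux `BoundaryDefectGaussianR`, stmt-CriticalPhenomena-14132; insertion dictionary D2, layer 3b)

For a general `Literature.Probability.LatticeModels.CollarLegModel` `M`, a height configuration
`h : M.freeCells → ℤ` and ANY completed bond configuration `β` (in the dictionary: `β = M.cfgOf ω`,
`ω ⊆ M.E`), a corner `c = (x, k)` carries the ORDERED LEVEL PAIR
`(M.hv h x, M.hf h f)`, `f = cFace c`: the heights of its vertex-cell and of its face-cell. A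
CONSISTENT turn (`M.TurnConsistent h β c`, file `CollarLegModelStrandsConsistency`) keeps it:

* across a CLOSED target edge the level line turns left around the same vertex `x`
  (`nextCorner_of_not_mem`) into the face `f'`, and consistency says `hf f = hf f'`;
* along an OPEN target edge it turns right inside the same face `f` (`cFace_nextCorner_of_mem`) to
  the vertex `x'`, and consistency says `hv x = hv x'`.

Hence (`hv_hf_iterate_nextCorner_eq`, induction on the number of turns) a run of consistent turns
transports the ordered level pair, in particular the unordered pair `{min, max}`
(`levelPair_iterate_nextCorner_eq`), the height difference and the arrow bit
(`bit_iterate_nextCorner_eq`). In the insertion dictionary this is the step "a strand joins two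
ends with the same level pair `(m, m+1)`" of the rainbow forcing (D2, layer 3b). Registered
sub-goal carried here: `s14_levelPair_along_strands` (stated for `β = M.cfgOf ω`).
-/

namespace Summit.CriticalPhenomena.CardyFormulaZ2.Cruxes.BoundaryDefectGaussianR.RainbowMonomialsInExcursionKernels

open Finset Literature.Probability.LatticeModels Literature.Probability.LatticeModels.CollarLegModel

section LevelPairs

variable (M : CollarLegModel) (h : ↥M.freeCells → ℤ) (β : Literature.Probability.Percolation.BondConfig (Site 2))

/-- **One consistent turn keeps the ordered level pair** `(hv x, hf f)` of a corner `(x, f)`: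
closed turn — same vertex, equal face heights; open turn — same face, equal vertex heights. [folklore] -/
theorem hv_hf_nextCorner_eq {c : Site 2 × Fin 4} (hc : M.TurnConsistent h β c) :
    M.hv h (ofSite (nextCorner β c).1) = M.hv h (ofSite c.1) ∧
      M.hf h (ofSite (cFace (nextCorner β c))) = M.hf h (ofSite (cFace c)) := by
  obtain ⟨-, -, hopen, hclosed⟩ := hc
  by_cases hb : cTgt c ∈ β
  · exact ⟨(hopen hb).symm, by rw [cFace_nextCorner_of_mem hb]⟩
  · exact ⟨by rw [nextCorner_of_not_mem hb], (hclosed hb).symm⟩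

/-- **A run of `n` consistent turns keeps the ordered level pair**: if the turns at
`c, σ c, …, σ^{n-1} c` (`σ = nextCorner β`) are all consistent for `h`, then `σ^n c` carries the
same vertex height and the same face height as `c`. [folklore] -/
theorem hv_hf_iterate_nextCorner_eq (n : ℕ) :
    ∀ c : Site 2 × Fin 4, (∀ m < n, M.TurnConsistent h β ((nextCorner β)^[m] c)) →
      M.hv h (ofSite ((nextCorner β)^[n] c).1) = M.hv h (ofSite c.1) ∧
        M.hf h (ofSite (cFace ((nextCorner β)^[n] c))) = M.hf h (ofSite (cFace c)) := by
  induction n with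
  | zero => intro c _; exact ⟨rfl, rfl⟩
  | succ n ih =>
    intro c hc
    have ih' := ih c fun m hm => hc m (Nat.lt_succ_of_lt hm)
    have hstep := hv_hf_nextCorner_eq M h β (hc n (Nat.lt_succ_self n))
    rw [Function.iterate_succ_apply']
    exact ⟨hstep.1.trans ih'.1, hstep.2.trans ih'.2⟩

/-- The UNORDERED level pair `{hv x, hf f}` (as `min`/`max`) is transported along a run of
consistent turns. [folklore] -/
theorem levelPair_iterate_nextCorner_eq (n : ℕ) (c : Site 2 × Fin 4)
    (hc : ∀ m < n, M.TurnConsistent h β ((nextCorner β)^[m] c)) :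
    min (M.hv h (ofSite ((nextCorner β)^[n] c).1)) (M.hf h (ofSite (cFace ((nextCorner β)^[n] c)))) =
        min (M.hv h (ofSite c.1)) (M.hf h (ofSite (cFace c))) ∧
      max (M.hv h (ofSite ((nextCorner β)^[n] c).1)) (M.hf h (ofSite (cFace ((nextCorner β)^[n] c)))) =
        max (M.hv h (ofSite c.1)) (M.hf h (ofSite (cFace c))) := by
  obtain ⟨h1, h2⟩ := hv_hf_iterate_nextCorner_eq M h β n c hc
  rw [h1, h2]
  exact ⟨rfl, rfl⟩

/-- The height difference `hv x - hf f` is transported along a run of consistent turns. [folklore] -/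
theorem hdiff_iterate_nextCorner_eq (n : ℕ) (c : Site 2 × Fin 4)
    (hc : ∀ m < n, M.TurnConsistent h β ((nextCorner β)^[m] c)) :
    M.hv h (ofSite ((nextCorner β)^[n] c).1) - M.hf h (ofSite (cFace ((nextCorner β)^[n] c))) =
      M.hv h (ofSite c.1) - M.hf h (ofSite (cFace c)) := by
  obtain ⟨h1, h2⟩ := hv_hf_iterate_nextCorner_eq M h β n c hc
  rw [h1, h2]

/-- The arrow bit `[hv x - hf f = 1]` is transported along a run of consistent turns (the
orientation of a strand is constant). [folklore] -/
theorem bit_iterate_nextCorner_eq (n : ℕ) (c : Site 2 × Fin 4)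
    (hc : ∀ m < n, M.TurnConsistent h β ((nextCorner β)^[m] c)) :
    M.bit h ((nextCorner β)^[n] c) = M.bit h c := by
  unfold bit
  rw [hdiff_iterate_nextCorner_eq M h β n c hc]

end LevelPairs

/-- Registered sub-goal `s14_levelPair_along_strands` of `stub_realisability` (D2, layer 3b): for a
general collar leg model, any height configuration, any set `ω` of open live edges and any corner
`c`, a run of `n` turns of the completed configuration `M.cfgOf ω` that are all consistent for `h`
transports the ordered level pair: `σ^n c` has the vertex height and the face height of `c`
(one-line form of `hv_hf_iterate_nextCorner_eq`). [folklore] -/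
theorem s14_levelPair_along_strands : ∀ (M : Literature.Probability.LatticeModels.CollarLegModel) (h : ↥M.freeCells → ℤ) (ω : Finset ((ℤ × ℤ) × Bool)) (c : Literature.Probability.LatticeModels.Site 2 × Fin 4) (n : ℕ), (∀ m < n, M.TurnConsistent h (M.cfgOf ω) ((Literature.Probability.LatticeModels.nextCorner (M.cfgOf ω))^[m] c)) → M.hv h (Literature.Probability.LatticeModels.CollarLegModel.ofSite ((Literature.Probability.LatticeModels.nextCorner (M.cfgOf ω))^[n] c).1) = M.hv h (Literature.Probability.LatticeModels.CollarLegModel.ofSite c.1) ∧ M.hf h (Literature.Probability.LatticeModels.CollarLegModel.ofSite (Literature.Probability.LatticeModels.cFace ((Literature.Probability.LatticeModels.nextCorner (M.cfgOf ω))^[n] c))) = M.hf h (Literature.Probability.LatticeModels.CollarLegModel.ofSite (Literature.Probability.LatticeModels.cFace c)) :=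
  fun M h ω c n hc => hv_hf_iterate_nextCorner_eq M h (M.cfgOf ω) n c hc

end Summit.CriticalPhenomena.CardyFormulaZ2.Cruxes.BoundaryDefectGaussianR.RainbowMonomialsInExcursionKernels
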